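import Summits.Ventures.PercRepro.Defs

/-!
# Finite multigraphs, open clusters, connection and partition events

A finite multigraph `G : MultiGraph V E` assigns to every edge `e : E` its two endpoints
`G.fst e`, `G.snd e` (loops and parallel edges allowed, exactly as in the enumeration engine's
input format).  For a configuration `ω : Config E`:

* `G.OpenAdj ω a b` — some open edge of `ω` joins `a` and `b`;
* `G.Conn ω u v` (`u ↔ v`) — `u` and `v` are joined by a path of open edges (the reflexive
  transitive closure of `OpenAdj`); it is an equivalence relation, monotone in `ω`;
* `G.cluster ω v` — the open cluster `C(v)`;
* `G.connEvent u v`, `G.sepEvent u v` — the events `{u ↔ v}` and `{u ↮ v}`; connection events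
  are increasing (`isUpperSet_connEvent`);
* `G.connPattern ω m`, `G.patternEvent m R` — for marked vertices `m : Fin k → V`, the
  connectivity pattern `R i j = [m i ↔ m j]` and the event that the pattern is `R`; these events
  partition the configuration space, so the partition law sums to `1`
  (`sum_prob_patternEvent`) and any event determined by the pattern is a sum of its rows
  (`prob_patternEvent_finset`);
* `G.partitionEvent m rgs` — the engine's partition-law row for the label string `rgs`
  (same label ⇔ same open cluster);
* `conn_update_true_iff`, `conn_update_false` — how connectivity changes when one edge is
  opened or closed (the contraction / deletion step of edge-induction proofs).
-/

namespace PercRepro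

open Finset

/-- A finite multigraph on the vertex type `V` with edge type `E`: every edge `e` joins
`fst e` and `snd e`.  Loops (`fst e = snd e`) and parallel edges are allowed. -/
structure MultiGraph (V E : Type*) where
  /-- first endpoint of an edge -/
  fst : E → V
  /-- second endpoint of an edge -/
  snd : E → V

namespace MultiGraph

variable {V E : Type*}

/-! ### Open adjacency and connectivity -/

section Conn

variable (G : MultiGraph V E)

/-- `G.OpenAdj ω a b`: some edge open in `ω` has endpoints `a` and `b` (in either order). -/
def OpenAdj (ω : Config E) (a b : V) : Prop :=
  ∃ e, ω e = true ∧ ((G.fst e = a ∧ G.snd e = b) ∨ (G.fst e = b ∧ G.snd e = a))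

/-- `G.Conn ω u v` (`u ↔ v`): `u` and `v` lie in the same open cluster of `ω`, i.e. they are
joined by a path of open edges. -/
def Conn (ω : Config E) (u v : V) : Prop := Relation.ReflTransGen (G.OpenAdj ω) u v

/-- An open edge joins its endpoints. -/
theorem openAdj_of_open (e : E) {ω : Config E} (he : ω e = true) :
    G.OpenAdj ω (G.fst e) (G.snd e) :=
  ⟨e, he, Or.inl ⟨rfl, rfl⟩⟩

/-- Every vertex is connected to itself. -/
theorem Conn.refl (ω : Config E) (u : V) : G.Conn ω u u := Relation.ReflTransGen.refl

variable {G}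

/-- Open adjacency is symmetric. -/
theorem OpenAdj.symm {ω : Config E} {a b : V} (h : G.OpenAdj ω a b) : G.OpenAdj ω b a := by
  obtain ⟨e, he, hab⟩ := h
  exact ⟨e, he, hab.symm⟩

/-- Open adjacency is monotone in the configuration. -/
theorem OpenAdj.mono {ω ω' : Config E} (h : ω ≤ ω') {a b : V} (hab : G.OpenAdj ω a b) :
    G.OpenAdj ω' a b := by
  obtain ⟨e, he, hend⟩ := hab
  exact ⟨e, Bool.le_iff_imp.1 (h e) he, hend⟩

/-- Openly adjacent vertices are connected. -/
theorem Conn.of_openAdj {ω : Config E} {u v : V} (h : G.OpenAdj ω u v) : G.Conn ω u v :=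
  Relation.ReflTransGen.single h

/-- Connectivity is transitive. -/
theorem Conn.trans {ω : Config E} {u v w : V} (huv : G.Conn ω u v) (hvw : G.Conn ω v w) :
    G.Conn ω u w :=
  Relation.ReflTransGen.trans huv hvw

/-- Connectivity is symmetric. -/
theorem Conn.symm {ω : Config E} {u v : V} (h : G.Conn ω u v) : G.Conn ω v u := by
  unfold Conn at h ⊢
  induction h with
  | refl => exact Relation.ReflTransGen.refl
  | tail _ hbc ih => exact (Relation.ReflTransGen.single hbc.symm).trans ih

/-- `u ↔ v` iff `v ↔ u`. -/
theorem conn_comm {ω : Config E} {u v : V} : G.Conn ω u v ↔ G.Conn ω v u :=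
  ⟨Conn.symm, Conn.symm⟩

/-- Connectivity is monotone in the configuration: opening edges only creates connections. -/
theorem Conn.mono {ω ω' : Config E} (h : ω ≤ ω') {u v : V} (huv : G.Conn ω u v) :
    G.Conn ω' u v := by
  unfold Conn at huv ⊢
  induction huv with
  | refl => exact Relation.ReflTransGen.refl
  | tail _ hbc ih => exact ih.tail (hbc.mono h)

/-- Induction along an open path: if `motive u` holds and `motive` propagates along open edges
(from a vertex already reached from `u`), then `motive v` holds for every `v` with `u ↔ v`. -/
theorem Conn.induction {ω : Config E} {u : V} {motive : V → Prop} (base : motive u)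
    (step : ∀ {a b}, G.Conn ω u a → G.OpenAdj ω a b → motive a → motive b)
    {v : V} (h : G.Conn ω u v) : motive v := by
  unfold Conn at h
  induction h with
  | refl => exact base
  | tail hab hbc ih => exact step hab hbc ih

variable (G)

/-- The connectivity relation of `ω` as a `Setoid` on the vertices. -/
def connSetoid (ω : Config E) : Setoid V where
  r := G.Conn ω
  iseqv := ⟨Conn.refl G ω, Conn.symm, Conn.trans⟩

/-- The open subgraph of `ω` as a `SimpleGraph` (loops dropped, parallel edges merged;
connectivity is unchanged, see `conn_iff_reachable`). -/
def openGraph (ω : Config E) : SimpleGraph V := SimpleGraph.fromRel (G.OpenAdj ω)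

/-- `u ↔ v` in `ω` iff `v` is reachable from `u` in the open subgraph. -/
theorem conn_iff_reachable (ω : Config E) (u v : V) :
    G.Conn ω u v ↔ (G.openGraph ω).Reachable u v := by
  rw [SimpleGraph.reachable_iff_reflTransGen]
  constructor
  · intro h
    unfold Conn at h
    induction h with
    | refl => exact Relation.ReflTransGen.refl
    | @tail b c _ hbc ih =>
      by_cases hbc' : b = c
      · subst hbc'
        exact ih
      · exact ih.tail ((SimpleGraph.fromRel_adj _ _ _).2 ⟨hbc', Or.inl hbc⟩)
  · intro h
    unfold Conn
    induction h with
    | refl => exact Relation.ReflTransGen.refl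
    | tail _ hbc ih =>
      exact ih.tail (((SimpleGraph.fromRel_adj _ _ _).1 hbc).2.elim id OpenAdj.symm)

end Conn

/-! ### Clusters and connection events -/

section Events

variable (G : MultiGraph V E)

/-- The open cluster `C(v)` of the vertex `v` in `ω`: all vertices connected to `v`. -/
def cluster (ω : Config E) (v : V) : Set V := {u | G.Conn ω v u}

/-- Membership in a cluster. -/
@[simp] theorem mem_cluster {ω : Config E} {u v : V} : u ∈ G.cluster ω v ↔ G.Conn ω v u :=
  Iff.rfl

/-- A vertex lies in its own cluster. -/
theorem self_mem_cluster (ω : Config E) (v : V) : v ∈ G.cluster ω v := Conn.refl G ω v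

/-- Clusters grow when edges are opened. -/
theorem cluster_mono {ω ω' : Config E} (h : ω ≤ ω') (v : V) :
    G.cluster ω v ⊆ G.cluster ω' v :=
  fun _ hu => Conn.mono h hu

/-- Connected vertices have the same cluster. -/
theorem cluster_eq_of_conn {ω : Config E} {u v : V} (h : G.Conn ω u v) :
    G.cluster ω u = G.cluster ω v := by
  ext w
  exact ⟨fun hw => h.symm.trans hw, fun hw => h.trans hw⟩

/-- The connection event `{u ↔ v}`. -/
def connEvent (u v : V) : Set (Config E) := {ω | G.Conn ω u v}

/-- The separation event `{u ↮ v}` (complement of the connection event). -/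
def sepEvent (u v : V) : Set (Config E) := (G.connEvent u v)ᶜ

/-- Membership in a connection event. -/
@[simp] theorem mem_connEvent {ω : Config E} {u v : V} : ω ∈ G.connEvent u v ↔ G.Conn ω u v :=
  Iff.rfl

/-- Membership in a separation event. -/
@[simp] theorem mem_sepEvent {ω : Config E} {u v : V} :
    ω ∈ G.sepEvent u v ↔ ¬ G.Conn ω u v :=
  Iff.rfl

/-- `{u ↔ v} = {v ↔ u}`. -/
theorem connEvent_comm (u v : V) : G.connEvent u v = G.connEvent v u := by
  ext ω
  exact conn_comm

/-- `{u ↔ u}` is the sure event. -/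
theorem connEvent_self (u : V) : G.connEvent u u = Set.univ := by
  ext ω
  simp [Conn.refl]

/-- Connection events are increasing. -/
theorem isUpperSet_connEvent (u v : V) : IsUpperSet (G.connEvent u v) :=
  fun _ _ h hω => Conn.mono h hω

/-- Separation events are decreasing. -/
theorem isLowerSet_sepEvent (u v : V) : IsLowerSet (G.sepEvent u v) :=
  (G.isUpperSet_connEvent u v).compl

variable {G}

/-- **Closed cut**: if no open edge of `ω` crosses the boundary of the vertex set `X`, then open
clusters of vertices of `X` stay inside `X`. -/
theorem mem_of_conn_of_closed_boundary {ω : Config E} {X : Set V}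
    (hX : ∀ e, ω e = true → (G.fst e ∈ X ↔ G.snd e ∈ X)) {u v : V} (hu : u ∈ X)
    (huv : G.Conn ω u v) : v ∈ X := by
  refine Conn.induction hu (fun {a b} _ hab ha => ?_) huv
  obtain ⟨e, he, hend⟩ := hab
  rcases hend with ⟨rfl, rfl⟩ | ⟨rfl, rfl⟩
  · exact (hX e he).1 ha
  · exact (hX e he).2 ha

/-- A vertex all of whose incident edges are closed is connected only to itself. -/
theorem eq_of_conn_of_isolated {ω : Config E} {v : V}
    (hv : ∀ e, ω e = true → G.fst e ≠ v ∧ G.snd e ≠ v) {u : V} (huv : G.Conn ω v u) : u = v :=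
  mem_of_conn_of_closed_boundary (X := {v})
    (fun e he => by simp [(hv e he).1, (hv e he).2]) rfl huv

/-- With every edge closed, connectivity is equality. -/
theorem eq_of_conn_of_forall_eq_false {ω : Config E} (h : ∀ e, ω e = false) {u v : V}
    (huv : G.Conn ω u v) : v = u :=
  eq_of_conn_of_isolated (fun e he => absurd (he.symm.trans (h e)) (by decide)) huv

end Events

/-! ### Marked vertices: connectivity patterns and the partition law -/

section Marked

variable (G : MultiGraph V E) {k : ℕ}

open Classical in
/-- The connectivity pattern of the marked vertices `m 0, …, m (k-1)` in `ω`: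
`G.connPattern ω m i j = true` iff `m i ↔ m j`.  (Classical, hence noncomputable; the
enumeration engine computes it exactly.) -/
noncomputable def connPattern (ω : Config E) (m : Fin k → V) : Fin k → Fin k → Bool :=
  fun i j => decide (G.Conn ω (m i) (m j))

/-- Reading off the pattern. -/
theorem connPattern_apply_iff {ω : Config E} {m : Fin k → V} {i j : Fin k} :
    G.connPattern ω m i j = true ↔ G.Conn ω (m i) (m j) := by
  simp [connPattern]

/-- The event that the marked vertices `m` are connected exactly according to the pattern `R`:
`m i ↔ m j` iff `R i j = true`. -/
def patternEvent (m : Fin k → V) (R : Fin k → Fin k → Bool) : Set (Config E) :=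
  {ω | ∀ i j, G.Conn ω (m i) (m j) ↔ R i j = true}

/-- Membership in a pattern event. -/
theorem mem_patternEvent {m : Fin k → V} {R : Fin k → Fin k → Bool} {ω : Config E} :
    ω ∈ G.patternEvent m R ↔ ∀ i j, (G.Conn ω (m i) (m j) ↔ R i j = true) :=
  Iff.rfl

/-- The pattern events are the fibres of `connPattern`. -/
theorem patternEvent_eq_preimage (m : Fin k → V) (R : Fin k → Fin k → Bool) :
    G.patternEvent m R = (fun ω => G.connPattern ω m) ⁻¹' {R} := by
  ext ω
  simp only [patternEvent, Set.mem_setOf_eq, Set.mem_preimage, Set.mem_singleton_iff,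
    funext_iff]
  constructor
  · intro h i j
    rw [Bool.eq_iff_iff, connPattern_apply_iff]
    exact h i j
  · intro h i j
    rw [← connPattern_apply_iff, h i j]

/-- The engine's partition-law row: the marked vertices are partitioned by open-cluster
connectivity exactly as prescribed by the label function `rgs` (same label ⇔ same cluster). -/
def partitionEvent (m : Fin k → V) (rgs : Fin k → ℕ) : Set (Config E) :=
  {ω | ∀ i j, G.Conn ω (m i) (m j) ↔ rgs i = rgs j}

/-- A partition row is the pattern event of the equality pattern of its labels. -/
theorem partitionEvent_eq_patternEvent (m : Fin k → V) (rgs : Fin k → ℕ) :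
    G.partitionEvent m rgs = G.patternEvent m (fun i j => decide (rgs i = rgs j)) := by
  ext ω
  simp [partitionEvent, patternEvent]

variable [Fintype E] [DecidableEq E]

/-- **The partition law sums to `1`**: summing the probabilities of all pattern events of the
marked vertices gives `1` (patterns that are not equivalence relations have probability `0`). -/
theorem sum_prob_patternEvent (p : E → ℝ) (m : Fin k → V) :
    ∑ R : Fin k → Fin k → Bool, prob p (G.patternEvent m R) = 1 := by
  simp only [patternEvent_eq_preimage]
  exact sum_prob_fiber p _

/-- Law of total probability over the partition of the marked vertices. -/
theorem prob_eq_sum_patternEvent (p : E → ℝ) (m : Fin k → V) (A : Set (Config E)) :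
    prob p A = ∑ R : Fin k → Fin k → Bool, prob p (A ∩ G.patternEvent m R) := by
  simp only [patternEvent_eq_preimage]
  exact prob_eq_sum_fiber p _ A

/-- An event determined by the pattern of the marked vertices (the pattern lies in the finite
set `T`) has probability equal to the sum of the corresponding rows of the partition law. -/
theorem prob_patternEvent_finset (p : E → ℝ) (m : Fin k → V)
    (T : Finset (Fin k → Fin k → Bool)) :
    prob p {ω | G.connPattern ω m ∈ T} = ∑ R ∈ T, prob p (G.patternEvent m R) := by
  simp only [patternEvent_eq_preimage]
  exact prob_preimage_coe p _ T

end Marked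

/-! ### Opening or closing one edge -/

section Update

variable {G : MultiGraph V E} [DecidableEq E]

/-- Closing an edge cannot create connections. -/
theorem conn_update_false {ω : Config E} {e : E} {u v : V}
    (h : G.Conn (Function.update ω e false) u v) : G.Conn ω u v :=
  h.mono (update_false_le ω e)

/-- Opening an edge cannot destroy connections. -/
theorem Conn.update_true {ω : Config E} {e : E} {u v : V} (h : G.Conn ω u v) :
    G.Conn (Function.update ω e true) u v :=
  h.mono (le_update_true ω e)

/-- **Contraction lemma**: after opening the edge `e = {a, b}`, `u ↔ v` iff already `u ↔ v`, or
`u ↔ a` and `b ↔ v`, or `u ↔ b` and `a ↔ v` (all in the original configuration). -/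
theorem conn_update_true_iff (ω : Config E) (e : E) (u v : V) :
    G.Conn (Function.update ω e true) u v ↔
      G.Conn ω u v ∨ (G.Conn ω u (G.fst e) ∧ G.Conn ω (G.snd e) v) ∨
        (G.Conn ω u (G.snd e) ∧ G.Conn ω (G.fst e) v) := by
  constructor
  · intro h
    unfold Conn at h
    induction h with
    | refl => exact Or.inl (Conn.refl G ω u)
    | @tail b c _ hbc ih =>
      obtain ⟨f, hf, hend⟩ := hbc
      by_cases hfe : f = e
      · subst hfe
        rcases hend with ⟨rfl, rfl⟩ | ⟨rfl, rfl⟩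
        · rcases ih with h | ⟨h1, _⟩ | ⟨h1, _⟩
          · exact Or.inr (Or.inl ⟨h, Conn.refl G ω _⟩)
          · exact Or.inr (Or.inl ⟨h1, Conn.refl G ω _⟩)
          · exact Or.inl h1
        · rcases ih with h | ⟨h1, _⟩ | ⟨h1, _⟩
          · exact Or.inr (Or.inr ⟨h, Conn.refl G ω _⟩)
          · exact Or.inl h1
          · exact Or.inr (Or.inr ⟨h1, Conn.refl G ω _⟩)
      · have hf' : ω f = true := by rwa [Function.update_of_ne hfe] at hf
        have hbc' : G.Conn ω b c := Conn.of_openAdj ⟨f, hf', hend⟩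
        rcases ih with h | ⟨h1, h2⟩ | ⟨h1, h2⟩
        · exact Or.inl (h.trans hbc')
        · exact Or.inr (Or.inl ⟨h1, h2.trans hbc'⟩)
        · exact Or.inr (Or.inr ⟨h1, h2.trans hbc'⟩)
  · have he : G.Conn (Function.update ω e true) (G.fst e) (G.snd e) :=
      Conn.of_openAdj (G.openAdj_of_open e (by simp))
    rintro (h | ⟨h1, h2⟩ | ⟨h1, h2⟩)
    · exact h.update_true
    · exact h1.update_true.trans (he.trans h2.update_true)
    · exact h1.update_true.trans (he.symm.trans h2.update_true)

end Update

end MultiGraph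

end PercRepro
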